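import Summits.Schanuel.Schanuel.Theorems.RootDecomp1BMovingZero12

/-!
# RootDecomp1BMovingZero — lens 4, generation 36 «AX-TRANSVERSAL MOVING ZERO»: SUB-PIECE B = the ARITHMETIC of the moved zero (ONE print fact `IsolatedPointBound` = KPS 2001 Cor. 2.10 + PINNING + q-bookkeeping PROVED) ⟹ `ApproxOfIsolated ρ` and `MovingZeroApprox ρ` for EVERY real ρ — continuation (RootDecomp1BMovingZero13): B-4 `approxOfIsolated_of_facts`, `movingZeroApprox_of_facts` + §B-5 CELL CLOSURE `movingZeroApprox_of_all_facts`, `four_le_polarDeg_one_of_all_facts`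

(lens-4 g36 HOME kernel MovingZeroPieceB.lean 579d1afa…, 819 l, import = tree RootDecomp1BMovingZero10 only; NOTE/CLAIM L1871, critic ACK L1875 (B design no objection; typing
requirements B1–B6), NODE L1891 / REQUEST L1892 / RESULT L1893, critic VERDICT L1894 (CLEARED · B-FACT ACCEPTED (B1–B6 all pass; fact budget T 1 · A 2 · B 1 = 4/4 USED) · the RESERVED CELL CREDIT B-R22 (a) AWARDED to lens-4 · PORT GO); port by census-1 gen 17 as `RootDecomp1BMovingZero11`–`13`: 11 = §B the B-FACT
`IsolatedPointBound` ((s, n)-general, Euclidean isolation ⟹ per-coordinate irreducible integer polynomial of degree ≤ Π Dᵢ and log-Mahler-measure ≤ (Π Dᵢ)(n log H +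
(2n+3) log(n+1)); corollary-composite of KPS 2001 Cor. 2.10 [KrickPardoSombra2001] + Bézout [Heintz1983] + [Chirka1989 §3.5]; named def, `--no-relocate`) + non-vacuity +
B-1 the five integer equations `sys` in 𝔸⁵ and the lifted point `pt`; 12 = B-2 PINNING `isolated_pt` (isolation in all five coordinates) + B-3 q-BOOKKEEPING; 13 = B-4
`approxOfIsolated_of_facts : AnalyticMovingZero → IsolatedPointBound → ∀ ρ, ApproxOfIsolated ρ`, `movingZeroApprox_of_facts` + §B-5 CELL CLOSURE
`movingZeroApprox_of_all_facts : CurveSelection → AxRankBoundLaurent → RoucheMaps → IsolatedZeroLowerBound → IsolatedPointBound → ∀ ρ, MovingZeroApprox ρ`,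
`four_le_polarDeg_one_of_all_facts`, `…_rhoT_…`. PORT EDITS: the `AxiomGuards` section (8 `#guard_msgs in #print axioms`) and `set_option linter.dupNamespace false` dropped;
ten one-line docstrings (`pt_*`, `sys_*`); statements and proofs verbatim. `--supports stmt-Schanuel-32406`; no census credit carried; rung 0 — nothing here proves Schanuel.)
-/

noncomputable section

open Complex Polynomial

namespace Summit.Schanuel.Schanuel.Theorems.RootDecomp1BMovingZero

section PieceBMain

open Filter Topology

/-- FACT B specialised to five equations in `𝔸⁵` (numerals `5 log H + 13 log 6` evaluated). -/
theorem isolatedPointBound_five (hB : IsolatedPointBound) (F : Fin 5 → MvPolynomial (Fin 5) ℤ) (D : Fin 5 → ℕ)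
    (H : ℕ) (ω : Fin 5 → ℂ) (hD : ∀ i, 1 ≤ D i) (hdeg : ∀ i, (F i).totalDegree ≤ D i) (hH : 1 ≤ H)
    (hcoeff : ∀ i m, |(F i).coeff m| ≤ (H : ℤ)) (hzero : ∀ i, MvPolynomial.aeval ω (F i) = 0)
    (hiso : ∀ᶠ ω' in 𝓝[≠] ω, ∃ i, MvPolynomial.aeval ω' (F i) ≠ 0) (j : Fin 5) :
    ∃ Q : ℤ[X], Irreducible Q ∧ 0 < Q.natDegree ∧ Polynomial.aeval (ω j) Q = 0 ∧
      (Q.natDegree : ℝ) ≤ ∏ i, (D i : ℝ) ∧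
        Real.log (Q.map (Int.castRingHom ℂ)).mahlerMeasure ≤ (∏ i, (D i : ℝ)) * (5 * Real.log H + 13 * Real.log 6) := by
  obtain ⟨Q, h1, h2, h3, h4, h5⟩ := hB 5 5 F D H ω hD hdeg hH hcoeff hzero hiso j
  refine ⟨Q, h1, h2, h3, h4, h5.trans_eq ?_⟩
  norm_num

/-- Degree-side bookkeeping: `D · N² ≤ D · B² · q²` for `0 ≤ N ≤ B q`. -/
theorem degree_side_le {D N B q : ℝ} (hD : 0 ≤ D) (hN0 : 0 ≤ N) (hN : N ≤ B * q) :
    D * (N * N) ≤ D * B ^ 2 * q ^ 2 := by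
  have hNN : N * N ≤ (B * q) * (B * q) := mul_le_mul hN hN hN0 (hN0.trans hN)
  calc D * (N * N) ≤ D * ((B * q) * (B * q)) := mul_le_mul_of_nonneg_left hNN hD
    _ = D * B ^ 2 * q ^ 2 := by ring

/-- Coefficient-side bookkeeping: `H = H₁ + H₂ + 2 + N ≤ (H₁ + H₂ + |ρ| + 4) (q + 1)` for `N ≤ (|ρ|+2) q`. -/
theorem coeff_side_le {a b c N q : ℝ} (ha : 0 ≤ a) (hb : 0 ≤ b) (hc : 0 ≤ c) (hq : 0 ≤ q)
    (hN : N ≤ (c + 2) * q) : a + b + 2 + N ≤ (a + b + c + 4) * (q + 1) := by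
  nlinarith

/-- Height-side bookkeeping: `5 log H + 13 log 6 ≤ (5 + 10 A + 26 log 6) · L` for `log H ≤ A + L`, `L ≥ 1/2`. -/
theorem height_side_le {A L x : ℝ} (hA : 0 ≤ A) (hL : 1 / 2 ≤ L) (hx : x ≤ A + L) :
    5 * x + 13 * Real.log 6 ≤ (5 + 10 * A + 26 * Real.log 6) * L := by
  have h6 : 0 ≤ Real.log 6 := Real.log_nonneg (by norm_num)
  have h1 : 10 * A * (1 / 2) ≤ 10 * A * L := mul_le_mul_of_nonneg_left hL (by positivity)
  have h2 : 26 * Real.log 6 * (1 / 2) ≤ 26 * Real.log 6 * L := mul_le_mul_of_nonneg_left hL (by positivity)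
  linarith

/-- `log (q + 1) ≥ 1/2` for `q ≥ 1`. -/
theorem half_le_log_den_add_one {q : ℕ} (hq : 1 ≤ q) : (1 : ℝ) / 2 ≤ Real.log ((q : ℝ) + 1) := by
  have hq' : (1 : ℝ) ≤ q := by exact_mod_cast hq
  have h2 : Real.log 2 ≤ Real.log ((q : ℝ) + 1) := Real.log_le_log two_pos (by linarith)
  have := Real.log_two_gt_d9
  linarith

/-- **THEOREM B (glue; PROVED modulo the facts A and B): `ApproxOfIsolated ρ` for EVERY real `ρ`.**
A gives the moving isolated zero `w_t` of the `t`-curves for `t = r = p/q` near `ρ` (B-0 = §A); B-1/B-2 lift it to an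
ISOLATED point of the `ℚ`-variety `V(E(r)) ⊂ ℂ⁵`; FACT B bounds degree and Mahler measure of its `X`-coordinate by
`Π Dᵢ = D₁D₂(q+|p|)² ≤ c₁ q²` and `Π Dᵢ · (5 log H + 13 log 6) ≤ c₂ q² log(q+1)` (B-3); `‖e − X_t‖ ≤ C|ρ − r|^κ`. -/
theorem approxOfIsolated_of_facts (hA : AnalyticMovingZero) (hB : IsolatedPointBound) (ρ : ℝ) :
    ApproxOfIsolated ρ := by
  intro _ K₁ K₂ G₁ G₂ hP hiso
  classical
  -- A: the moving zero at θ; the slit-plane ball; smallness; the threshold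
  obtain ⟨δ, C, κ, hδ, hC, hκ, hmove⟩ := movingZero_theta hA hP hiso
  obtain ⟨η, hη, hball⟩ := exists_ball_theta_slit
  obtain ⟨δB, hδB, hsmall⟩ := exists_delta_rpow_lt C hκ hη
  have hε : 0 < min 1 (min δ δB) := lt_min one_pos (lt_min hδ hδB)
  obtain ⟨q₀, hq₀⟩ := exists_nat_exp_neg_lt hε
  -- the q-independent data of the system: degrees and coefficient bounds of `E₁`, `E₂`
  obtain ⟨D₁, hD₁1, hD₁deg⟩ : ∃ D₁ : ℕ, 1 ≤ D₁ ∧ (relPoly G₁ 3).totalDegree ≤ D₁ :=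
    ⟨max 1 (relPoly G₁ 3).totalDegree, le_max_left _ _, le_max_right _ _⟩
  obtain ⟨D₂, hD₂1, hD₂deg⟩ : ∃ D₂ : ℕ, 1 ≤ D₂ ∧ (relPoly G₂ 4).totalDegree ≤ D₂ :=
    ⟨max 1 (relPoly G₂ 4).totalDegree, le_max_left _ _, le_max_right _ _⟩
  obtain ⟨H₁, hH₁⟩ := exists_coeff_abs_le (relPoly G₁ 3)
  obtain ⟨H₂, hH₂⟩ := exists_coeff_abs_le (relPoly G₂ 4)
  have hH₁0 : (0 : ℝ) ≤ H₁ := Nat.cast_nonneg _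
  have hH₂0 : (0 : ℝ) ≤ H₂ := Nat.cast_nonneg _
  have hρ0 : 0 ≤ |ρ| := abs_nonneg ρ
  have hApos : 0 < (H₁ : ℝ) + H₂ + |ρ| + 4 := by linarith
  have hlogA : 0 ≤ Real.log ((H₁ : ℝ) + H₂ + |ρ| + 4) := Real.log_nonneg (by linarith)
  -- the constants of `ApproxData ρ`
  unfold ApproxData
  refine ⟨C, κ, hC, hκ, (D₁ : ℝ) * D₂ * (|ρ| + 2) ^ 2,
    (D₁ : ℝ) * D₂ * (|ρ| + 2) ^ 2 * (5 + 10 * Real.log ((H₁ : ℝ) + H₂ + |ρ| + 4) + 26 * Real.log 6), q₀, ?_⟩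
  intro r hqr hr
  have hq1 : 1 ≤ r.den := r.den_pos
  have hqpos : (0 : ℝ) < r.den := Nat.cast_pos.mpr r.den_pos
  have hlt : |ρ - r| < min 1 (min δ δB) := hr.trans (hq₀ r.den hqr)
  have hlt1 : |ρ - r| < 1 := hlt.trans_le (min_le_left _ _)
  have hltδ : |ρ - r| < δ := (hlt.trans_le (min_le_right _ _)).trans_le (min_le_left _ _)
  have hltδB : |ρ - r| < δB := (hlt.trans_le (min_le_right _ _)).trans_le (min_le_right _ _)
  -- the complex parameter `t = r`
  have ht : ‖((r : ℚ) : ℂ) - (ρ : ℂ)‖ = |ρ - r| := by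
    rw [← Complex.ofReal_ratCast, ← Complex.ofReal_sub, Complex.norm_real, Real.norm_eq_abs, abs_sub_comm]
  obtain ⟨w, hw0, hwiso, hwle⟩ := hmove (r : ℂ) (by rw [ht]; exact hltδ)
  rw [ht] at hwle
  -- `w` is `η`-close to `θ`: both coordinates off the cut
  have hwη : ‖w - (cexp 1, cexp Complex.I)‖ < η := hwle.trans_lt (hsmall _ (abs_nonneg _) hltδB)
  obtain ⟨hXs, hYs⟩ := hball w hwη
  have hX0 : w.1 ≠ 0 := Complex.slitPlane_ne_zero hXs
  have hY0 : w.2 ≠ 0 := Complex.slitPlane_ne_zero hYs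
  -- B-1/B-2: the lifted point is an ISOLATED common zero of `E(r)` in `ℂ⁵`
  have hzero : ∀ i, MvPolynomial.aeval (pt r w) (sys G₁ G₂ r i) = 0 := aeval_sys_pt G₁ G₂ r hX0 hY0 hw0
  have hisol := isolated_pt G₁ G₂ r hXs hYs hwiso
  -- B-3: degree and coefficient data of `E(r)`
  have hN1 : 1 ≤ r.den + r.num.natAbs := by omega
  have hDpos : ∀ i, 1 ≤ (![1, D₁, D₂, r.den + r.num.natAbs, r.den + r.num.natAbs] : Fin 5 → ℕ) i := by
    intro i
    fin_cases i
    · exact le_rfl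
    · exact hD₁1
    · exact hD₂1
    · exact hN1
    · exact hN1
  have hDdeg : ∀ i, (sys G₁ G₂ r i).totalDegree ≤
      (![1, D₁, D₂, r.den + r.num.natAbs, r.den + r.num.natAbs] : Fin 5 → ℕ) i := by
    intro i
    fin_cases i
    · exact totalDegree_linPoly _ _
    · exact hD₁deg
    · exact hD₂deg
    · exact totalDegree_powPoly _ _ _ _
    · exact totalDegree_powPoly _ _ _ _
  have hH1 : 1 ≤ H₁ + H₂ + 2 + (r.den + r.num.natAbs) := by omega
  have hHcoeff : ∀ i m, |(sys G₁ G₂ r i).coeff m| ≤ ((H₁ + H₂ + 2 + (r.den + r.num.natAbs) : ℕ) : ℤ) := by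
    intro i m
    have h₁ : (0 : ℤ) ≤ H₁ := Nat.cast_nonneg _
    have h₂ : (0 : ℤ) ≤ H₂ := Nat.cast_nonneg _
    have hq : (0 : ℤ) ≤ r.den := Nat.cast_nonneg _
    have hp : (0 : ℤ) ≤ |r.num| := abs_nonneg _
    have hcast : ((H₁ + H₂ + 2 + (r.den + r.num.natAbs) : ℕ) : ℤ) = H₁ + H₂ + 2 + (r.den + |r.num|) := by
      push_cast
      ring
    rw [hcast]
    fin_cases i
    · exact (coeff_linPoly_abs_le _ _ m).trans (by linarith)
    · exact (hH₁ m).trans (by linarith)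
    · exact (hH₂ m).trans (by linarith)
    · exact (coeff_powPoly_abs_le _ _ _ _ m).trans (by linarith)
    · exact (coeff_powPoly_abs_le _ _ _ _ m).trans (by linarith)
  -- FACT B at the lifted point, coordinate `X`
  obtain ⟨Q, hirr, hdeg0, hroot, hdegle, hM⟩ := isolatedPointBound_five hB (sys G₁ G₂ r)
    ![1, D₁, D₂, r.den + r.num.natAbs, r.den + r.num.natAbs] (H₁ + H₂ + 2 + (r.den + r.num.natAbs)) (pt r w)
    hDpos hDdeg hH1 hHcoeff hzero hisol 1
  rw [pt_one] at hroot
  -- the product of the degrees and its q-bound (degree side)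
  have hprod : ∏ i, ((![1, D₁, D₂, r.den + r.num.natAbs, r.den + r.num.natAbs] : Fin 5 → ℕ) i : ℝ) =
      (D₁ : ℝ) * D₂ * (((r.den + r.num.natAbs : ℕ) : ℝ) * ((r.den + r.num.natAbs : ℕ) : ℝ)) := by
    rw [Fin.prod_univ_five]
    simp only [Matrix.cons_val_zero, Matrix.cons_val_one, Matrix.cons_val]
    push_cast
    ring
  rw [hprod] at hdegle hM
  have hP : (D₁ : ℝ) * D₂ * (((r.den + r.num.natAbs : ℕ) : ℝ) * ((r.den + r.num.natAbs : ℕ) : ℝ)) ≤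
      (D₁ : ℝ) * D₂ * (|ρ| + 2) ^ 2 * (r.den : ℝ) ^ 2 :=
    degree_side_le (by positivity) (Nat.cast_nonneg _) (den_add_natAbs_num_le hlt1)
  -- the height side: `H ≤ A (q+1)`, `log H ≤ log A + log (q+1)`, `log (q+1) ≥ 1/2`
  have hHR : ((H₁ + H₂ + 2 + (r.den + r.num.natAbs) : ℕ) : ℝ) ≤
      ((H₁ : ℝ) + H₂ + |ρ| + 4) * ((r.den : ℝ) + 1) := by
    push_cast
    exact coeff_side_le hH₁0 hH₂0 hρ0 hqpos.le (by exact_mod_cast den_add_natAbs_num_le hlt1)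
  have hHpos : (0 : ℝ) < ((H₁ + H₂ + 2 + (r.den + r.num.natAbs) : ℕ) : ℝ) := by
    exact_mod_cast (show 0 < H₁ + H₂ + 2 + (r.den + r.num.natAbs) by omega)
  have hlogH : Real.log (((H₁ + H₂ + 2 + (r.den + r.num.natAbs) : ℕ) : ℝ)) ≤
      Real.log ((H₁ : ℝ) + H₂ + |ρ| + 4) + Real.log ((r.den : ℝ) + 1) := by
    rw [← Real.log_mul hApos.ne' (by positivity)]
    exact Real.log_le_log hHpos hHR
  have hlogH0 : 0 ≤ Real.log (((H₁ + H₂ + 2 + (r.den + r.num.natAbs) : ℕ) : ℝ)) :=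
    Real.log_nonneg (by exact_mod_cast hH1)
  have hB0 : 0 ≤ 5 * Real.log (((H₁ + H₂ + 2 + (r.den + r.num.natAbs) : ℕ) : ℝ)) + 13 * Real.log 6 := by
    have h6 : 0 ≤ Real.log 6 := Real.log_nonneg (by norm_num)
    linarith
  have hBle := height_side_le hlogA (half_le_log_den_add_one hq1) hlogH
  refine ⟨Q, w.1, hirr, hdeg0, hroot, hdegle.trans hP, ?_, ?_⟩
  · -- Mahler measure
    calc Real.log (Q.map (Int.castRingHom ℂ)).mahlerMeasure
        ≤ (D₁ : ℝ) * D₂ * (((r.den + r.num.natAbs : ℕ) : ℝ) * ((r.den + r.num.natAbs : ℕ) : ℝ)) *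
            (5 * Real.log (((H₁ + H₂ + 2 + (r.den + r.num.natAbs) : ℕ) : ℝ)) + 13 * Real.log 6) := hM
      _ ≤ ((D₁ : ℝ) * D₂ * (|ρ| + 2) ^ 2 * (r.den : ℝ) ^ 2) *
            ((5 + 10 * Real.log ((H₁ : ℝ) + H₂ + |ρ| + 4) + 26 * Real.log 6) * Real.log ((r.den : ℝ) + 1)) :=
          mul_le_mul hP hBle hB0 (by positivity)
      _ = (D₁ : ℝ) * D₂ * (|ρ| + 2) ^ 2 * (5 + 10 * Real.log ((H₁ : ℝ) + H₂ + |ρ| + 4) + 26 * Real.log 6) *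
            (r.den : ℝ) ^ 2 * Real.log ((r.den : ℝ) + 1) := by ring
  · -- closeness of `ξ = X_t` to `e`
    calc ‖cexp 1 - w.1‖ = ‖(w - (cexp 1, cexp Complex.I)).1‖ := by rw [Prod.fst_sub, norm_sub_rev]
      _ ≤ ‖w - (cexp 1, cexp Complex.I)‖ := norm_fst_le _
      _ ≤ C * |ρ - r| ^ κ := hwle

/-- **COROLLARY (glue, PROVED mod A, B): T ⟹ `MovingZeroApprox ρ`** — the kernel's (iii)+(iv) at `ρ`. -/
theorem movingZeroApprox_of_facts (hA : AnalyticMovingZero) (hB : IsolatedPointBound) {ρ : ℝ}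
    (hT : IsolatedIntersection ρ) : MovingZeroApprox ρ :=
  movingZeroApprox_of hT (approxOfIsolated_of_facts hA hB ρ)

end PieceBMain

section CellClosure

open Summit.Schanuel.Schanuel.Theorems.RootDecomp1KHyper (LWMeasure)
open Summit.Schanuel.Schanuel.Theorems.RootDecomp1KHyper.HyperCell (HyperLiouville ExplicitRatExpApprox)
open Summit.Schanuel.Schanuel.Theorems.RootDecomp1KGeneric (LiouvilleOrder)
open Summit.Schanuel.Schanuel.Theorems.RootDecomp1KFiniteOrderCell (towerNumber)
open Summit.Schanuel.Schanuel.Theorems.RootDecomp1BFedFlagCore (polarDeg)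

/-! ## §B-5  THE CELL's MZ INPUT AND THE CELL, every input NAMED (compositions only; T = parts 05–10, A = part 04,
B = this file, cell theorems = part 02) -/

/-- `ApproxOfIsolated ρ` (piece M′ of the kernel) for EVERY real `ρ`, modulo A's two print facts and B's one. -/
theorem approxOfIsolated_of_all_facts (hR : RoucheMaps) (hL : IsolatedZeroLowerBound) (hB : IsolatedPointBound)
    (ρ : ℝ) : ApproxOfIsolated ρ :=
  approxOfIsolated_of_facts (analyticMovingZero_of_facts hR hL) hB ρ

/-- **THE CELL's MZ INPUT `MovingZeroApprox ρ` FOR EVERY REAL `ρ`**, modulo the five moving-zero inputs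
{`CurveSelection` (T), `AxRankBoundLaurent` (Ax 1971, by name), `RoucheMaps`, `IsolatedZeroLowerBound` (A),
`IsolatedPointBound` (B)} — T″ ∘ A ∘ B. -/
theorem movingZeroApprox_of_all_facts (hCS : CurveSelection) (hAx : AxRankBoundLaurent) (hR : RoucheMaps)
    (hL : IsolatedZeroLowerBound) (hB : IsolatedPointBound) (ρ : ℝ) : MovingZeroApprox ρ :=
  movingZeroApprox_of_facts (analyticMovingZero_of_facts hR hL) hB (isolatedIntersection_of_curveSelection hCS hAx ρ)

/-- **THE CELL X(2) AT `(1, ρ)` for every real `ρ` of exponential Liouville order `8`** (hence every hyper- and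
every ultra-Liouville `ρ`), modulo the two registered E-side facts of the kernel (`LWMeasure`, `ExplicitRatExpApprox`)
and the five moving-zero inputs. -/
theorem four_le_polarDeg_one_of_all_facts (hLW : LWMeasure) (hX : ExplicitRatExpApprox) (hCS : CurveSelection)
    (hAx : AxRankBoundLaurent) (hR : RoucheMaps) (hL : IsolatedZeroLowerBound) (hB : IsolatedPointBound) {ρ : ℝ}
    (hρ : LiouvilleOrder 8 ρ) : ((2 + 2 : ℕ) : Cardinal) ≤ polarDeg ![(1 : ℝ), ρ] :=
  four_le_polarDeg_one_of_movingZero hLW hX hρ (movingZeroApprox_of_all_facts hCS hAx hR hL hB ρ)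

/-- … the swapped cell `(ρ, 1)`. -/
theorem four_le_polarDeg_swap_of_all_facts (hLW : LWMeasure) (hX : ExplicitRatExpApprox) (hCS : CurveSelection)
    (hAx : AxRankBoundLaurent) (hR : RoucheMaps) (hL : IsolatedZeroLowerBound) (hB : IsolatedPointBound) {ρ : ℝ}
    (hρ : LiouvilleOrder 8 ρ) : ((2 + 2 : ℕ) : Cardinal) ≤ polarDeg ![ρ, (1 : ℝ)] :=
  four_le_polarDeg_swap_of_movingZero hLW hX hρ (movingZeroApprox_of_all_facts hCS hAx hR hL hB ρ)

/-- … the hyper-Liouville class (1K item 33363's class). -/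
theorem four_le_polarDeg_one_hyper_of_all_facts (hLW : LWMeasure) (hX : ExplicitRatExpApprox) (hCS : CurveSelection)
    (hAx : AxRankBoundLaurent) (hR : RoucheMaps) (hL : IsolatedZeroLowerBound) (hB : IsolatedPointBound) {ρ : ℝ}
    (hρ : HyperLiouville ρ) : ((2 + 2 : ℕ) : Cardinal) ≤ polarDeg ![(1 : ℝ), ρ] :=
  four_le_polarDeg_one_hyper hLW hX hρ (movingZeroApprox_of_all_facts hCS hAx hR hL hB ρ)

/-- **X(2) AT `(1, ρ_T)`, `ρ_T = towerNumber 9` NOT hyper-Liouville** (part 02 `not_hyperLiouville_rhoT`): a storey-two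
cell strictly BELOW the hyper/ultra classes, modulo the same named inputs. -/
theorem four_le_polarDeg_one_rhoT_of_all_facts (hLW : LWMeasure) (hX : ExplicitRatExpApprox) (hCS : CurveSelection)
    (hAx : AxRankBoundLaurent) (hR : RoucheMaps) (hL : IsolatedZeroLowerBound) (hB : IsolatedPointBound) :
    ((2 + 2 : ℕ) : Cardinal) ≤ polarDeg ![(1 : ℝ), towerNumber 9] :=
  four_le_polarDeg_one_rhoT hLW hX (movingZeroApprox_of_all_facts hCS hAx hR hL hB (towerNumber 9))

end CellClosure

end Summit.Schanuel.Schanuel.Theorems.RootDecomp1BMovingZero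

end
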